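import Literature.MathematicalPhysics.QuantumFieldTheory.Jegerlehner2017.SpectralFunctionInsertions
import Literature.Analysis.SpecialFunctions.DilogarithmRealArgument

/-!
# (R-IBP), part I: pointwise algebra of `ρ₄/W`, the dilogarithm block `G`, the primitive `P`, and the generic integration-by-parts assembly

HONEST FRAMING: independent recomputation; certified where stated, statistical where stated; no new-physics claim.

Cell `pub-qed`, unit `pub-qed-lit` (venture `QEDPrecision`). STATUS NOTE (added 2026-08-20, same seat, docstring only —
no declaration changed): this file is the lit seat's CONCURRENT, INDEPENDENT kernel proof of the pointwise algebra,
the primitive, the dilogarithm-bracket derivative and the generic integration-by-parts assembly behind (R-IBP); it is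
NOT load-bearing. The planned parts 2–3 (`RIBPIntegrability`, `RIBP`) were NOT filed: the integrator seat (quad) landed
the same identity first, and ITS chain is the (R-IBP) kernel theorem OF RECORD —
`Summits/Ventures/QEDPrecision/Integrands/KallenSabryPhi.lean` → `KallenSabryPhiIntegrable.lean` → `KallenSabryIBP.lean`
(`Summit.Ventures.QEDPrecision.Integrands.integral_rho4_div_wt_eq_integral_phiIBP`, cell decision D229; referee kernel
reads r67/r68); lit's agreed complement is `KallenSabry/RIBPControls.lean` (explicit Φ, C₆/C₈ transports) and
`KallenSabry/GroupsEight.lean`. ORIGINAL SCOPE: the elementary representation (R-IBP) of the Källén–Sabry insertion at the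
dispersive kernel argument, `J₄(x) = ∫₀¹ ρ₄(t)/W_t(x) dt = ∫₀¹ Φ(t,x) dt` (`0 < x < 1`), used by the cell's certified
evaluation of the tenth-order sets I(b), I(c) (`certs/SetIbIc/`, representation note `repr/R-IBP.md`: "CAS-derived,
re-derived by hand by both referees, numerically verified — NOT Lean-proved"; that qualifier is retired by quad's chain,
not by this file alone). The objects are the tree's typed PUBLISHED ones: `ρ₄` = Jegerlehner STMP 274 (2017) eq. (3.160) VERBATIM
[cite: Jegerlehner2017, eq. (3.160)], `W_t(x)` = eq. (3.158) [cite: Jegerlehner2017, eq. (3.158)]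
(`Literature/…/Jegerlehner2017/SpectralFunctionInsertions.lean`), `Li₂` of a real argument = `reDilog`
[cite: Morris1979, eq. (1)] (`= realDilog`, the series, on `[−1,1]`). (R-IBP) itself is the cell's own one-line
integration by parts (no published source; nothing is cited for it and no value is asserted anywhere in this file).

THIS FILE (R-IBP.md "DERIVATION", step by step):
* `rho4_div_wt_eq` — on `(0,1)²`: `ρ₄/W = q·ln((1+t)/2)·L + p·(T₂L + T₃ + T₄) + q·G`, `p = 2tx²/(3((2−x)²−x²t²))`
  (the `(1−t²)` of `1/W` cancels the `1/(1−t²)` of (3.160)), `q = p(3−t²)(1+t²)/2`, `L = ln((1+t)/(1−t))`,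
  `G(t) = π²/6 + 2Li₂((1−t)/(1+t)) + 2Li₂((1+t)/2) − 2Li₂((1−t)/2) − 4Li₂(t) + Li₂(t²)`;
* `hasDerivAt_P`, `P_zero` — `P(t) = (1/6)[t⁴/2 + (a²−2)t² + (a²−3)(a²+1)ln(1−t²/a²)]` has `P′ = t(3−t²)(1+t²)/(3(a²−t²))`
  (`= q` at `a = (2−x)/x`) and `P(0) = 0`;
* `continuousOn_G`, `G_one`, `hasDerivAt_G` — `G` is continuous on `[0,1]`, `G(1) = 0`
  (`Σᵢ cᵢ Li₂(zᵢ(1)) = (2 − 4 + 1)ζ(2)` cancels `Li₂(1)`), and on `(0,1)` `G′ = −S`,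
  `S = −4ln(2t/(1+t))/(1−t²) + 2ln((1−t)/2)/(1+t) + 2ln((1+t)/2)/(1−t) − 2ln(1−t)/t + 2ln(1+t)/t`
  (`(d/dt)Li₂(z) = −ln(1−z)z′/z`, `Literature.Analysis.SpecialFunctions.hasDerivAt_reDilog`);
* `integral_mul_eq_of_parts`, `integral_eq_of_parts` — the generic assembly: `∫₀¹ qG = [PG]₀¹ − ∫₀¹ PG′ = ∫₀¹ PS`
  (Mathlib `intervalIntegral.integral_deriv_mul_eq_sub_of_hasDerivAt`, derivatives on the OPEN interval, boundary
  values by continuity) and `∫ f = ∫(E₁ + PS)` from `f = E₁ + qG` a.e.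
No definitions, no `sorry`, zero `kit` compute; axioms standard.
-/

noncomputable section

open Real Set MeasureTheory intervalIntegral

namespace Summit.Ventures.QEDPrecision.KallenSabry

open Literature.Analysis.SpecialFunctions (realDilog reDilog reDilog_eq_realDilog realDilog_one
  reDilog_one reDilog_zero hasDerivAt_reDilog continuous_reDilog)
open Literature.MathematicalPhysics.QuantumFieldTheory.Jegerlehner2017 (rho4 wt)

/-! ## §1 Pointwise algebra -/

/-- §1 (R-IBP.md "DERIVATION", first clause). For `0 < x < 1`, `0 < t < 1`:
`ρ₄(t)/W_t(x) = q·ln((1+t)/2)·L + p·(T₂L + T₃ + T₄) + q·G(t)` with `p = 2tx²/(3((2−x)²−x²t²))`,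
`q = p(3−t²)(1+t²)/2`, `L = ln((1+t)/(1−t))` and the dilogarithm block
`G(t) = π²/6 + 2Li₂((1−t)/(1+t)) + 2Li₂((1+t)/2) − 2Li₂((1−t)/2) − 4Li₂(t) + Li₂(t²)` (`Li₂ = reDilog`;
the `(1−t²)` of `1/W` cancels the `1/(1−t²)` of (3.160)). -/
theorem rho4_div_wt_eq {x t : ℝ} (hx0 : 0 < x) (hx1 : x < 1) (ht0 : 0 ≤ t) (ht1 : t < 1) :
    rho4 t / wt t x 1 =
      2 * t * x ^ 2 / (3 * ((2 - x) ^ 2 - x ^ 2 * t ^ 2)) * ((3 - t ^ 2) * (1 + t ^ 2) / 2)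
          * log ((1 + t) / 2) * log ((1 + t) / (1 - t))
        + 2 * t * x ^ 2 / (3 * ((2 - x) ^ 2 - x ^ 2 * t ^ 2)) *
          ((11 / 16 * (3 - t ^ 2) * (1 + t ^ 2) + t ^ 4 / 4 - 3 / 2 * t * (3 - t ^ 2))
              * log ((1 + t) / (1 - t))
            + t * (3 - t ^ 2) * (3 * log ((1 + t) / 2) - 2 * log t) + 3 / 8 * t * (5 - 3 * t ^ 2))
        + 2 * t * x ^ 2 / (3 * ((2 - x) ^ 2 - x ^ 2 * t ^ 2)) * ((3 - t ^ 2) * (1 + t ^ 2) / 2) *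
          (π ^ 2 / 6 + 2 * reDilog ((1 - t) / (1 + t)) + 2 * reDilog ((1 + t) / 2)
            - 2 * reDilog ((1 - t) / 2) - 4 * reDilog t + reDilog (t ^ 2)) := by
  have hz1 : |(1 - t) / (1 + t)| ≤ 1 := by
    rw [abs_le]; constructor
    · rw [le_div_iff₀ (by linarith)]; linarith
    · rw [div_le_iff₀ (by linarith)]; linarith
  have hz2 : |(1 + t) / 2| ≤ 1 := by rw [abs_le]; constructor <;> linarith
  have hz3 : |(1 - t) / 2| ≤ 1 := by rw [abs_le]; constructor <;> linarith
  have hz4 : |t| ≤ 1 := by rw [abs_le]; constructor <;> linarith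
  have hz5 : |t ^ 2| ≤ 1 := by rw [abs_le]; constructor <;> nlinarith
  unfold rho4 wt
  rw [realDilog_one, ← reDilog_eq_realDilog hz1, ← reDilog_eq_realDilog hz2,
    ← reDilog_eq_realDilog hz3, ← reDilog_eq_realDilog hz4, ← reDilog_eq_realDilog hz5]
  have ht2 : t ^ 2 < 1 := by nlinarith
  have h1t : 1 - t ^ 2 ≠ 0 := by linarith
  have hx : x ≠ 0 := hx0.ne'
  have hx2 : 0 < x ^ 2 := by positivity
  have hxt : x ^ 2 * t ^ 2 < x ^ 2 * 1 := mul_lt_mul_of_pos_left ht2 hx2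
  have hD : (2 - x) ^ 2 - x ^ 2 * t ^ 2 ≠ 0 := by nlinarith
  have hW : (1 : ℝ) + 4 / (1 - t ^ 2) * ((1 - x) / x ^ 2) * 1
      = ((2 - x) ^ 2 - x ^ 2 * t ^ 2) / ((1 - t ^ 2) * x ^ 2) := by
    field_simp; ring
  rw [hW]
  field_simp
  ring

/-! ## §2 The primitive `P` of `q` -/

/-- §3. The primitive `P(t) = (1/6)[t⁴/2 + (a²−2)t² + (a²−3)(a²+1)ln(1 − t²/a²)]` of
`q = t(3−t²)(1+t²)/(3(a²−t²))` on `|t| < a` (R-IBP.md: "P(t,x) = ∫₀ᵗ q(τ,x)dτ"). -/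
theorem hasDerivAt_P {a t : ℝ} (ha : 0 < a) (ht : |t| < a) :
    HasDerivAt (fun t : ℝ => 1 / 6 * (t ^ 4 / 2 + (a ^ 2 - 2) * t ^ 2
        + (a ^ 2 - 3) * (a ^ 2 + 1) * log (1 - t ^ 2 / a ^ 2)))
      (t * (3 - t ^ 2) * (1 + t ^ 2) / (3 * (a ^ 2 - t ^ 2))) t := by
  have hta : t ^ 2 < a ^ 2 := sq_lt_sq' (by linarith [(abs_lt.1 ht).1]) (abs_lt.1 ht).2
  have ha2 : 0 < a ^ 2 := by positivity
  have harg : 0 < 1 - t ^ 2 / a ^ 2 := by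
    rw [sub_pos, div_lt_one ha2]; exact hta
  have hin : HasDerivAt (fun t : ℝ => 1 - t ^ 2 / a ^ 2) (-(↑2 * t ^ (2 - 1) / a ^ 2)) t :=
    ((hasDerivAt_pow 2 t).div_const (a ^ 2)).const_sub 1
  have hlog : HasDerivAt (fun t : ℝ => log (1 - t ^ 2 / a ^ 2))
      ((-(↑2 * t ^ (2 - 1) / a ^ 2)) / (1 - t ^ 2 / a ^ 2)) t := hin.log harg.ne'
  have hpoly : HasDerivAt (fun t : ℝ => t ^ 4 / 2 + (a ^ 2 - 2) * t ^ 2)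
      (↑4 * t ^ (4 - 1) / 2 + (a ^ 2 - 2) * (↑2 * t ^ (2 - 1))) t :=
    ((hasDerivAt_pow 4 t).div_const 2).add ((hasDerivAt_pow 2 t).const_mul (a ^ 2 - 2))
  have h := (hpoly.add (hlog.const_mul ((a ^ 2 - 3) * (a ^ 2 + 1)))).const_mul (1 / 6)
  have hat : a ^ 2 - t ^ 2 ≠ 0 := by linarith
  have e : 1 / 6 * (↑4 * t ^ (4 - 1) / 2 + (a ^ 2 - 2) * (↑2 * t ^ (2 - 1))
        + (a ^ 2 - 3) * (a ^ 2 + 1) * (-(↑2 * t ^ (2 - 1) / a ^ 2) / (1 - t ^ 2 / a ^ 2)))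
      = t * (3 - t ^ 2) * (1 + t ^ 2) / (3 * (a ^ 2 - t ^ 2)) := by
    simp only [Nat.add_one_sub_one]
    have e1 : -(2 * t ^ 1 / a ^ 2) / (1 - t ^ 2 / a ^ 2) = -(2 * t) / (a ^ 2 - t ^ 2) := by
      rw [div_eq_div_iff harg.ne' hat]
      field_simp
    rw [e1, eq_div_iff (by positivity : (3 : ℝ) * (a ^ 2 - t ^ 2) ≠ 0)]
    field_simp
    ring
  rw [← e]
  exact h

/-- `P(0) = 0`. -/
theorem P_zero (a : ℝ) :
    (fun t : ℝ => 1 / 6 * (t ^ 4 / 2 + (a ^ 2 - 2) * t ^ 2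
        + (a ^ 2 - 3) * (a ^ 2 + 1) * log (1 - t ^ 2 / a ^ 2))) 0 = 0 := by
  simp

/-! ## §3 The dilogarithm block `G` -/

/-- §2a. `G` is continuous on `[0, 1]`. -/
theorem continuousOn_G :
    ContinuousOn (fun t : ℝ => π ^ 2 / 6 + 2 * reDilog ((1 - t) / (1 + t)) + 2 * reDilog ((1 + t) / 2)
        - 2 * reDilog ((1 - t) / 2) - 4 * reDilog t + reDilog (t ^ 2)) (Icc 0 1) := by
  have hc : Continuous reDilog := continuous_reDilog
  have h1 : ContinuousOn (fun t : ℝ => reDilog ((1 - t) / (1 + t))) (Icc 0 1) :=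
    hc.comp_continuousOn ((continuousOn_const.sub continuousOn_id).div
      (continuousOn_const.add continuousOn_id)
      (fun t ht => by simp only [Set.mem_Icc] at ht; linarith))
  have h2 : Continuous (fun t : ℝ => reDilog ((1 + t) / 2)) := hc.comp (by fun_prop)
  have h3 : Continuous (fun t : ℝ => reDilog ((1 - t) / 2)) := hc.comp (by fun_prop)
  have h5 : Continuous (fun t : ℝ => reDilog (t ^ 2)) := hc.comp (continuous_pow 2)
  refine ((((continuousOn_const.add (continuousOn_const.mul h1)).add
    (continuousOn_const.mul h2.continuousOn)).sub (continuousOn_const.mul h3.continuousOn)).sub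
    (continuousOn_const.mul hc.continuousOn)).add h5.continuousOn

/-- §2b. `G(1) = 0`: `Σᵢ cᵢ Li₂(zᵢ(1)) = (2 − 4 + 1)ζ(2) = −ζ(2)` cancels `Li₂(1) = ζ(2)`. -/
theorem G_one :
    (fun t : ℝ => π ^ 2 / 6 + 2 * reDilog ((1 - t) / (1 + t)) + 2 * reDilog ((1 + t) / 2)
        - 2 * reDilog ((1 - t) / 2) - 4 * reDilog t + reDilog (t ^ 2)) 1 = 0 := by
  simp only [sub_self, zero_div, one_pow, reDilog_zero, reDilog_one]
  norm_num [reDilog_one]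
  ring

/-- §2c. On `(0,1)`: `G′ = −S`, `S(t) = −4ln(2t/(1+t))/(1−t²) + 2ln((1−t)/2)/(1+t) + 2ln((1+t)/2)/(1−t)
− 2ln(1−t)/t + 2ln(1+t)/t` (`(d/dt)Li₂(z) = −ln(1−z)z′/z`). -/
theorem hasDerivAt_G {t : ℝ} (ht0 : 0 < t) (ht1 : t < 1) :
    HasDerivAt (fun t : ℝ => π ^ 2 / 6 + 2 * reDilog ((1 - t) / (1 + t)) + 2 * reDilog ((1 + t) / 2)
        - 2 * reDilog ((1 - t) / 2) - 4 * reDilog t + reDilog (t ^ 2))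
      (-(-4 * log (2 * t / (1 + t)) / (1 - t ^ 2) + 2 * log ((1 - t) / 2) / (1 + t)
          + 2 * log ((1 + t) / 2) / (1 - t) - 2 * log (1 - t) / t + 2 * log (1 + t) / t)) t := by
  have h1t : (0:ℝ) < 1 + t := by linarith
  have h1t' : (0:ℝ) < 1 - t := by linarith
  -- inner maps
  have hz1 : HasDerivAt (fun t : ℝ => (1 - t) / (1 + t))
      (((-1) * (1 + t) - (1 - t) * 1) / (1 + t) ^ 2) t :=
    ((hasDerivAt_id t).const_sub 1).div ((hasDerivAt_id t).const_add 1) h1t.ne'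
  have hz2 : HasDerivAt (fun t : ℝ => (1 + t) / 2) (1 / 2) t :=
    ((hasDerivAt_id t).const_add 1).div_const 2
  have hz3 : HasDerivAt (fun t : ℝ => (1 - t) / 2) (-1 / 2) t :=
    ((hasDerivAt_id t).const_sub 1).div_const 2
  have hz5 : HasDerivAt (fun t : ℝ => t ^ 2) (↑2 * t ^ (2 - 1)) t := hasDerivAt_pow 2 t
  -- the five dilogarithms (arguments in (0,1), away from 0 and 1)
  have hd1 : HasDerivAt (fun t : ℝ => reDilog ((1 - t) / (1 + t)))
      (-(log (1 - (1 - t) / (1 + t)) / ((1 - t) / (1 + t)))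
        * (((-1) * (1 + t) - (1 - t) * 1) / (1 + t) ^ 2)) t := by
    refine (hasDerivAt_reDilog ?_ ?_).comp t hz1
    · exact div_ne_zero h1t'.ne' h1t.ne'
    · rw [Ne, div_eq_one_iff_eq h1t.ne']; linarith
  have hd2 : HasDerivAt (fun t : ℝ => reDilog ((1 + t) / 2))
      (-(log (1 - (1 + t) / 2) / ((1 + t) / 2)) * (1 / 2)) t := by
    refine (hasDerivAt_reDilog ?_ ?_).comp t hz2
    · positivity
    · intro h; linarith
  have hd3 : HasDerivAt (fun t : ℝ => reDilog ((1 - t) / 2))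
      (-(log (1 - (1 - t) / 2) / ((1 - t) / 2)) * (-1 / 2)) t := by
    refine (hasDerivAt_reDilog ?_ ?_).comp t hz3
    · positivity
    · intro h; linarith
  have hd4 : HasDerivAt (fun t : ℝ => reDilog t) (-(log (1 - t) / t)) t :=
    hasDerivAt_reDilog ht0.ne' ht1.ne
  have hd5 : HasDerivAt (fun t : ℝ => reDilog (t ^ 2))
      (-(log (1 - t ^ 2) / t ^ 2) * (↑2 * t ^ (2 - 1))) t := by
    refine (hasDerivAt_reDilog ?_ ?_).comp t hz5
    · positivity
    · intro h; nlinarith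
  have h := (((((hasDerivAt_const t (π ^ 2 / 6)).add (hd1.const_mul 2)).add (hd2.const_mul 2)).sub
    (hd3.const_mul 2)).sub (hd4.const_mul 4)).add hd5
  refine h.congr_deriv ?_
  -- simplify the logarithms' arguments
  have e1 : log (1 - (1 - t) / (1 + t)) = log (2 * t / (1 + t)) := by
    congr 1; field_simp; ring
  have e2 : log (1 - (1 + t) / 2) = log ((1 - t) / 2) := by congr 1; ring
  have e3 : log (1 - (1 - t) / 2) = log ((1 + t) / 2) := by congr 1; ring
  have e5 : log (1 - t ^ 2) = log (1 - t) + log (1 + t) := by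
    rw [show (1:ℝ) - t ^ 2 = (1 - t) * (1 + t) by ring, Real.log_mul h1t'.ne' h1t.ne']
  rw [e1, e2, e3, e5]
  have h1t2 : (1:ℝ) - t ^ 2 ≠ 0 := by nlinarith
  have ht0' : t ≠ 0 := ht0.ne'
  simp only [Nat.add_one_sub_one, pow_one]
  field_simp
  ring

/-! ## §4 Integration by parts and assembly (generic in the functions) -/

/-- §5a. `∫₀¹ qG = ∫₀¹ PS` when `P' = q`, `G' = −S` on `(0,1)`, `P(0) = 0`, `G(1) = 0`. -/
theorem integral_mul_eq_of_parts {q G P S : ℝ → ℝ}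
    (hPc : ContinuousOn P (Icc 0 1)) (hGc : ContinuousOn G (Icc 0 1))
    (hPd : ∀ t ∈ Ioo (0:ℝ) 1, HasDerivAt P (q t) t)
    (hGd : ∀ t ∈ Ioo (0:ℝ) 1, HasDerivAt G (-S t) t)
    (hq : IntervalIntegrable q volume 0 1) (hS : IntervalIntegrable S volume 0 1)
    (hP0 : P 0 = 0) (hG1 : G 1 = 0) :
    ∫ t in (0:ℝ)..1, q t * G t = ∫ t in (0:ℝ)..1, P t * S t := by
  have hS' : IntervalIntegrable (fun t => -S t) volume 0 1 := hS.neg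
  have hPc' : ContinuousOn P (uIcc 0 1) := by rwa [uIcc_of_le zero_le_one]
  have hGc' : ContinuousOn G (uIcc 0 1) := by rwa [uIcc_of_le zero_le_one]
  have h := intervalIntegral.integral_deriv_mul_eq_sub_of_hasDerivAt
    (u := P) (v := G) (u' := q) (v' := fun t => -S t) (a := 0) (b := 1) hPc' hGc'
    (by intro t ht; rw [min_eq_left zero_le_one, max_eq_right zero_le_one] at ht; exact hPd t ht)
    (by intro t ht; rw [min_eq_left zero_le_one, max_eq_right zero_le_one] at ht; exact hGd t ht)
    hq hS'
  rw [hP0, hG1, mul_zero, zero_mul, sub_zero] at h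
  have hqG : IntervalIntegrable (fun t => q t * G t) volume 0 1 := hq.mul_continuousOn hGc'
  have hPS : IntervalIntegrable (fun t => P t * -S t) volume 0 1 := hS'.continuousOn_mul hPc'
  rw [intervalIntegral.integral_add hqG hPS] at h
  have e : ∫ t in (0:ℝ)..1, P t * -S t = -∫ t in (0:ℝ)..1, P t * S t := by
    rw [← intervalIntegral.integral_neg]
    congr 1; funext t; ring
  rw [e] at h
  linarith

/-- §5b. Assembly: `f = E₁ + qG` on `(0,1)` and `∫qG = ∫PS` give `∫f = ∫(E₁ + PS)`. -/
theorem integral_eq_of_parts {f E₁ q G P S : ℝ → ℝ}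
    (hf : ∀ t ∈ Ioo (0:ℝ) 1, f t = E₁ t + q t * G t)
    (hE : IntervalIntegrable E₁ volume 0 1)
    (hqG : IntervalIntegrable (fun t => q t * G t) volume 0 1)
    (hPS : IntervalIntegrable (fun t => P t * S t) volume 0 1)
    (hparts : ∫ t in (0:ℝ)..1, q t * G t = ∫ t in (0:ℝ)..1, P t * S t) :
    ∫ t in (0:ℝ)..1, f t = ∫ t in (0:ℝ)..1, (E₁ t + P t * S t) := by
  have h1 : ∫ t in (0:ℝ)..1, f t = ∫ t in (0:ℝ)..1, (E₁ t + q t * G t) := by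
    refine intervalIntegral.integral_congr_uIoo ?_
    intro t ht
    rw [uIoo_of_le zero_le_one] at ht
    exact hf t ht
  rw [h1, intervalIntegral.integral_add hE hqG, hparts, ← intervalIntegral.integral_add hE hPS]


end Summit.Ventures.QEDPrecision.KallenSabry

end
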